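import Summits.FinalStateConjecture.FinalStateConjecture.Theses.KerrnessPropagates

/-!
# Route `KerrnessPropagates`, crux `KerrBasinCapture` (stmt-FinalStateConjecture-17646), line `registered`
# (skeleton `Cruxes/KerrBasinCapture/Lines/birth.lean`, lead rev 3) — stub `stub_directionDodging`

Direction dodging in Euclidean `3`-space (stub T2b). Given `N` ball centres `Xᵢ : E3`, all at
distance `≥ D` from a point `z`, with `32 (N + 1) ρ ≤ D` and `0 < ρ`, there is a unit vector
`e` such that the closed ray `s ↦ z + s • e` (`s ≥ 0`) keeps distance `≥ ρ` from every centre.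
In the slab-transfer argument this ray transports the time orientation of a chart along a
lab-space path avoiding the `N` black-hole near zones.

Proof (elementary Euclidean geometry, no trigonometry). Fix an orthonormal pair `u₁, u₂`
(two vectors of the standard basis of `E3`) and the `N + 1` candidate directions
`v_m = u₁ + (m / (N + 1)) • u₂`, `m : Fin (N + 1)`.
* Blocking estimate (`dd_block`): if `‖t • (u₁ + a • u₂) - w‖ < ρ` with `t ≥ 0` and
  `0 ≤ a ≤ 1`, then pairing with `u₁`, `u₂` gives `|t - ⟪w, u₁⟫| < ρ`, `|t a - ⟪w, u₂⟫| < ρ`,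
  and the triangle inequality gives `‖w‖ < 2 t + ρ`.
* Two candidates `a + δ ≤ a'` (`δ > 0`) blocked by the same centre `w` force
  `δ (‖w‖ - ρ) < 8 ρ` (`dd_pair`); with `δ = 1 / (N + 1)` and `‖w‖ ≥ D ≥ 32 (N + 1) ρ` this is
  absurd (`dd_noTwo`).
* Pigeonhole (`Fintype.exists_ne_map_eq_of_card_lt`): `N` balls cannot block all `N + 1`
  candidates, so some `v_m` spans a free ray; the answer is `e = ‖v_m‖⁻¹ • v_m`.
-/

open scoped InnerProductSpace
open Literature.Geometry.Lorentzian

-- D-0017: single-problem summit, `Summit.<S>.<S>.…` by design.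
set_option linter.dupNamespace false

namespace Summit.FinalStateConjecture.FinalStateConjecture.Theorems.KerrnessPropagates.KerrBasinCapture

section Helpers

variable {F : Type*} [NormedAddCommGroup F] [InnerProductSpace ℝ F]

/-- Blocking estimate. If the ray point `t • (u₁ + a • u₂)` (`t ≥ 0`, `0 ≤ a ≤ 1`, `u₁, u₂`
orthonormal) is `ρ`-close to `w`, then `t` is `ρ`-close to `⟪w, u₁⟫`, `t a` is `ρ`-close to
`⟪w, u₂⟫`, and `‖w‖ < 2 t + ρ`. -/
private theorem dd_block {u₁ u₂ w : F} (hu₁ : ‖u₁‖ = 1) (hu₂ : ‖u₂‖ = 1)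
    (h12 : ⟪u₁, u₂⟫_ℝ = 0) {a t ρ : ℝ} (ha0 : 0 ≤ a) (ha1 : a ≤ 1) (ht : 0 ≤ t)
    (hb : ‖t • (u₁ + a • u₂) - w‖ < ρ) :
    |t - ⟪w, u₁⟫_ℝ| < ρ ∧ |t * a - ⟪w, u₂⟫_ℝ| < ρ ∧ ‖w‖ < 2 * t + ρ := by
  have h11 : ⟪u₁, u₁⟫_ℝ = 1 := by rw [real_inner_self_eq_norm_sq, hu₁, one_pow]
  have h22 : ⟪u₂, u₂⟫_ℝ = 1 := by rw [real_inner_self_eq_norm_sq, hu₂, one_pow]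
  have h21 : ⟪u₂, u₁⟫_ℝ = 0 := by rw [real_inner_comm, h12]
  have hx1 : ⟪t • (u₁ + a • u₂) - w, u₁⟫_ℝ = t - ⟪w, u₁⟫_ℝ := by
    rw [inner_sub_left, real_inner_smul_left, inner_add_left, real_inner_smul_left, h11, h21]
    ring
  have hx2 : ⟪t • (u₁ + a • u₂) - w, u₂⟫_ℝ = t * a - ⟪w, u₂⟫_ℝ := by
    rw [inner_sub_left, real_inner_smul_left, inner_add_left, real_inner_smul_left, h12, h22]
    ring
  refine ⟨?_, ?_, ?_⟩
  · rw [← hx1]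
    calc |⟪t • (u₁ + a • u₂) - w, u₁⟫_ℝ| ≤ ‖t • (u₁ + a • u₂) - w‖ * ‖u₁‖ :=
          abs_real_inner_le_norm _ _
      _ = ‖t • (u₁ + a • u₂) - w‖ := by rw [hu₁, mul_one]
      _ < ρ := hb
  · rw [← hx2]
    calc |⟪t • (u₁ + a • u₂) - w, u₂⟫_ℝ| ≤ ‖t • (u₁ + a • u₂) - w‖ * ‖u₂‖ :=
          abs_real_inner_le_norm _ _
      _ = ‖t • (u₁ + a • u₂) - w‖ := by rw [hu₂, mul_one]
      _ < ρ := hb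
  · have hv : ‖u₁ + a • u₂‖ ≤ 2 := by
      calc ‖u₁ + a • u₂‖ ≤ ‖u₁‖ + ‖a • u₂‖ := norm_add_le _ _
        _ = 1 + |a| := by rw [norm_smul, hu₁, hu₂, Real.norm_eq_abs, mul_one]
        _ ≤ 2 := by rw [abs_of_nonneg ha0]; linarith
    have htv : ‖t • (u₁ + a • u₂)‖ ≤ 2 * t := by
      rw [norm_smul, Real.norm_eq_abs, abs_of_nonneg ht]
      nlinarith [norm_nonneg (u₁ + a • u₂)]
    have hw : ‖w‖ ≤ ‖t • (u₁ + a • u₂)‖ + ‖t • (u₁ + a • u₂) - w‖ := by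
      calc ‖w‖ = ‖t • (u₁ + a • u₂) - (t • (u₁ + a • u₂) - w)‖ := by rw [sub_sub_cancel]
        _ ≤ ‖t • (u₁ + a • u₂)‖ + ‖t • (u₁ + a • u₂) - w‖ := norm_sub_le _ _
    linarith

/-- Two candidates blocked by the same centre are close. If both `t • (u₁ + a • u₂)` and
`t' • (u₁ + a' • u₂)` are `ρ`-close to `w` (`t, t' ≥ 0`, `0 ≤ a`, `a + δ ≤ a' ≤ 1`, `δ > 0`),
then `δ (‖w‖ - ρ) < 8 ρ`. -/
private theorem dd_pair {u₁ u₂ w : F} (hu₁ : ‖u₁‖ = 1) (hu₂ : ‖u₂‖ = 1)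
    (h12 : ⟪u₁, u₂⟫_ℝ = 0) {a a' t t' ρ δ : ℝ} (ha0 : 0 ≤ a) (ha1' : a' ≤ 1) (hδ : 0 < δ)
    (haa' : a + δ ≤ a') (ht : 0 ≤ t) (ht' : 0 ≤ t')
    (hb : ‖t • (u₁ + a • u₂) - w‖ < ρ) (hb' : ‖t' • (u₁ + a' • u₂) - w‖ < ρ) :
    δ * (‖w‖ - ρ) < 8 * ρ := by
  have hρ : 0 < ρ := lt_of_le_of_lt (norm_nonneg _) hb
  have ha1 : a ≤ 1 := by linarith
  have ha0' : 0 ≤ a' := by linarith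
  obtain ⟨h1, h2, -⟩ := dd_block hu₁ hu₂ h12 ha0 ha1 ht hb
  obtain ⟨h1', h2', h3'⟩ := dd_block hu₁ hu₂ h12 ha0' ha1' ht' hb'
  rw [abs_lt] at h1 h2 h1' h2'
  -- `t' (a' - a) = (t' a' - w₂) + (w₂ - t a) + (t - t') a < 2 ρ + 2 ρ a ≤ 4 ρ`
  have hP1 : 0 ≤ (2 * ρ - (t - t')) * a := mul_nonneg (by linarith) ha0
  have hP2 : 0 ≤ ρ * (1 - a) := mul_nonneg hρ.le (by linarith)
  have hkey : t' * (a' - a) < 4 * ρ := by nlinarith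
  -- `δ (‖w‖ - ρ) < 2 t' δ ≤ 2 t' (a' - a) < 8 ρ`
  have hA : δ * (‖w‖ - ρ) < δ * (2 * t') := mul_lt_mul_of_pos_left (by linarith) hδ
  have hB : 2 * t' * δ ≤ 2 * t' * (a' - a) := mul_le_mul_of_nonneg_left (by linarith) (by linarith)
  nlinarith

/-- Two distinct candidates `m < m'` of the family `u₁ + (m / (N + 1)) • u₂` cannot both be
blocked by a centre `w` with `‖w‖ ≥ D ≥ 32 (N + 1) ρ`. -/
private theorem dd_noTwo {u₁ u₂ w : F} (hu₁ : ‖u₁‖ = 1) (hu₂ : ‖u₂‖ = 1)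
    (h12 : ⟪u₁, u₂⟫_ℝ = 0) {N : ℕ} {ρ D t t' : ℝ} (hD : 32 * ((N : ℝ) + 1) * ρ ≤ D)
    (hw : D ≤ ‖w‖) {m m' : Fin (N + 1)} (hmm' : m < m') (ht : 0 ≤ t) (ht' : 0 ≤ t')
    (hb : ‖t • (u₁ + (((m : ℕ) : ℝ) / ((N : ℝ) + 1)) • u₂) - w‖ < ρ)
    (hb' : ‖t' • (u₁ + (((m' : ℕ) : ℝ) / ((N : ℝ) + 1)) • u₂) - w‖ < ρ) : False := by
  have hN : (0 : ℝ) < (N : ℝ) + 1 := by positivity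
  have hN0 : (0 : ℝ) ≤ (N : ℝ) := Nat.cast_nonneg N
  have hρ : 0 < ρ := lt_of_le_of_lt (norm_nonneg _) hb
  have ha0 : (0 : ℝ) ≤ ((m : ℕ) : ℝ) / ((N : ℝ) + 1) := by positivity
  have ha1' : ((m' : ℕ) : ℝ) / ((N : ℝ) + 1) ≤ 1 := by
    rw [div_le_one hN]
    have h : (m' : ℕ) ≤ N + 1 := (Fin.is_lt m').le
    exact_mod_cast h
  have hδ : (0 : ℝ) < 1 / ((N : ℝ) + 1) := by positivity
  have haa' : ((m : ℕ) : ℝ) / ((N : ℝ) + 1) + 1 / ((N : ℝ) + 1)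
      ≤ ((m' : ℕ) : ℝ) / ((N : ℝ) + 1) := by
    rw [← add_div, div_le_div_iff_of_pos_right hN]
    have h : (m : ℕ) + 1 ≤ (m' : ℕ) := by have := Fin.lt_def.mp hmm'; omega
    exact_mod_cast h
  have key := dd_pair hu₁ hu₂ h12 ha0 ha1' hδ haa' ht ht' hb hb'
  rw [one_div, inv_mul_lt_iff₀ hN] at key
  nlinarith [mul_nonneg hN0 hρ.le]

end Helpers

/-- stub T2b — DIRECTION DODGING (registered stub of crux stmt-FinalStateConjecture-17646, line
`registered`). Given `N` centres `Xᵢ : E3` with `D ≤ ‖z - Xᵢ‖` for all `i`, `0 < ρ` and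
`32 (N + 1) ρ ≤ D`, some unit vector `e` spans a closed ray `z + s • e` (`s ≥ 0`) staying at
distance `≥ ρ` from every centre. Proof: among the `N + 1` candidate directions
`u₁ + (m / (N + 1)) • u₂` (`u₁, u₂` orthonormal) no two are blocked by the same ball
(`dd_noTwo`), so by pigeonhole one is blocked by none; normalise it. [folklore] -/
theorem stub_directionDodging : ∀ (N : ℕ) (X : Fin N → E3) (z : E3) (ρ D : ℝ), 0 < ρ → 32 * ((N : ℝ) + 1) * ρ ≤ D → (∀ i, D ≤ ‖z - X i‖) → ∃ e : E3, ‖e‖ = 1 ∧ ∀ i, ∀ s : ℝ, 0 ≤ s → ρ ≤ ‖z + s • e - X i‖ := by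
  intro N X z ρ D _ hD hfar
  -- an orthonormal pair in `E3`
  obtain ⟨u₁, u₂, hu₁, hu₂, h12⟩ : ∃ u₁ u₂ : E3, ‖u₁‖ = 1 ∧ ‖u₂‖ = 1 ∧ ⟪u₁, u₂⟫_ℝ = 0 :=
    ⟨EuclideanSpace.basisFun (Fin 3) ℝ 0, EuclideanSpace.basisFun (Fin 3) ℝ 1,
      (EuclideanSpace.basisFun (Fin 3) ℝ).orthonormal.1 0,
      (EuclideanSpace.basisFun (Fin 3) ℝ).orthonormal.1 1,
      (EuclideanSpace.basisFun (Fin 3) ℝ).orthonormal.2 (by decide)⟩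
  -- some candidate direction `u₁ + (m / (N + 1)) • u₂` spans a ray blocked by no ball
  obtain ⟨m, hm⟩ : ∃ m : Fin (N + 1), ∀ i, ∀ t : ℝ, 0 ≤ t →
      ρ ≤ ‖t • (u₁ + (((m : ℕ) : ℝ) / ((N : ℝ) + 1)) • u₂) - (X i - z)‖ := by
    by_contra hcon
    push Not at hcon
    choose g t ht hlt using hcon
    obtain ⟨m, m', hne, hgg⟩ := Fintype.exists_ne_map_eq_of_card_lt g (by simp)
    have hw : D ≤ ‖X (g m) - z‖ := by rw [norm_sub_rev]; exact hfar (g m)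
    rcases lt_or_gt_of_ne hne with hlt' | hlt'
    · exact dd_noTwo hu₁ hu₂ h12 hD hw hlt' (ht m) (ht m') (hlt m) (by rw [hgg]; exact hlt m')
    · exact dd_noTwo hu₁ hu₂ h12 hD hw hlt' (ht m') (ht m) (by rw [hgg]; exact hlt m') (hlt m)
  -- the free candidate, normalised
  set v : E3 := u₁ + (((m : ℕ) : ℝ) / ((N : ℝ) + 1)) • u₂ with hv
  have hv0 : v ≠ 0 := by
    intro h0
    have h11 : ⟪u₁, u₁⟫_ℝ = 1 := by rw [real_inner_self_eq_norm_sq, hu₁, one_pow]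
    have h21 : ⟪u₂, u₁⟫_ℝ = 0 := by rw [real_inner_comm, h12]
    have h1 : ⟪v, u₁⟫_ℝ = 1 := by
      rw [hv, inner_add_left, real_inner_smul_left, h11, h21, mul_zero, add_zero]
    rw [h0, inner_zero_left] at h1
    exact zero_ne_one h1
  have hnv : 0 < ‖v‖ := norm_pos_iff.mpr hv0
  refine ⟨‖v‖⁻¹ • v, ?_, ?_⟩
  · rw [norm_smul, norm_inv, norm_norm, inv_mul_cancel₀ hnv.ne']
  · intro i s hs
    have key := hm i (s * ‖v‖⁻¹) (mul_nonneg hs (inv_nonneg.mpr hnv.le))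
    calc ρ ≤ ‖(s * ‖v‖⁻¹) • v - (X i - z)‖ := key
      _ = ‖z + s • (‖v‖⁻¹ • v) - X i‖ := by
        rw [smul_smul]
        congr 1
        abel

end Summit.FinalStateConjecture.FinalStateConjecture.Theorems.KerrnessPropagates.KerrBasinCapture
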